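import Literature.AnabelianGeometry.EtaleTheta.RootsOfUnityPadicOrders
import Literature.AnabelianGeometry.EtaleTheta.SettingModelKrullCusp
import Literature.AnabelianGeometry.EtaleTheta.SettingModelChiThetaCusp
import HarnessLib

/-!
# «`K` contains a primitive `l`-th root of unity» — the binder `hμK : ∀ ζ ∈ μ_N(ℚ̄_p), ζ ∈ K` of the Cor. 2.9 count:
# DISCHARGED for `N ∣ p − 1` at EVERY setting, and its EXACT census at base field `K = ℚ_p` (the models `κ′`, `χ′`)

S. Mochizuki, *The étale theta function and its Frobenioid-theoretic manifestations*, Publ. RIMS **45** (2009) [EtTh], §2, Rmk. 2.6.1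
p. 40 («Suppose, for simplicity, that `K` contains a primitive `l`-th root of unity. Then …»), Cor. 2.9 p. 43
[cite: MochizukiEtTh2009, Rmk 2.6.1 p.40]; J.-P. Serre, *A course in arithmetic*, Ch. II §3.1 Prop. 7 (roots of unity of `ℚ_p`)
[cite: Serre1973, Ch. II §3.1 Prop. 7]. Cell abc-iut, layer L2, seat abc-iut-L2-t10 (gen 6), Krull row K12 (census sequel of
R488 «Cor 2.9@κ′»; companion of K11 `SettingModelKrullCyclotomeModEmpty`). PROOF-ONLY (0 definitions).

WHY. abc-iut-L2-d3's six-member cusp count `exists_temperedCoverData_natCard_cuspOrbits_of_cuspLaws` (and this seat's κ′ instance K8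
`exists_temperedCoverData_natCard_cuspOrbits_inversionModelκ'`) carry print's hypothesis as the binder
`hμK : ∀ ζ : MuN p l, ζ ∈ K` next to the cyclotome datum `μ : CyclotomeMod 1 l`. With abc-iut-w5-d125 / abc-iut-w5-d091's
arithmetic of `μ_N(ℚ̄_p)` (`RootsOfUnityPadicOrders`: a primitive `N`-th root of unity lies IN `ℚ_p` iff `N ∣ p − 1 ∨ (p = 2 ∧ N = 2)`,
`galMuN_eq_one_iff`), the binder is settled:

* `coe_muN_mem_intermediateField_of_dvd_pred_or` — for `N ∣ p − 1` (or `p = N = 2`), `μ_N(ℚ̄_p) ⊆ K` for EVERY intermediate field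
  `K / ℚ_p` (all `N`-th roots are powers of a primitive one in `ℚ_p`); **`ThetaSetting.coe_muN_mem_K_of_dvd_pred_or`** — the binder
  `hμK` DISCHARGED at every `ThetaSetting` for such `N`;
* `dvd_pred_or_of_coe_muN_mem_bot`, **`coe_muN_mem_bot_iff`** — at base field `K = ℚ_p` the binder holds IFF `N ∣ p − 1 ∨ (p = 2 ∧ N = 2)`
  (a Galois-fixed root of unity forces the mod-`N` cyclotomic character of `ℚ_p` to vanish);
* at the models with `K = ℚ_p` (`(modelκ′ p).K = ⊥`, `(modelχ′ p).K = ⊥`, `rfl`): **`hμK_modelκ'_iff`**, **`hμK_modelχ'_iff`**, and for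
  ODD `l` `hμK_modelκ'_iff_of_odd` / `hμK_modelχ'_iff_of_odd`: the binder holds iff `l ∣ p − 1`.

CENSUS of the κ′ six-member count (with K10 / K11): binders = {Prop. 2.6 (F-0610; UNDECIDED at κ′, Q-L2t10g6-P26κ′), `μ : CyclotomeMod 1 l`
(EMPTY unless `l ∣ p − 1`, K11; inhabited for `l ∣ p − 1`: OPEN), `hμK` (⇔ `l ∣ p − 1`, THIS file)}. HONEST LIMITS: field arithmetic of
`ℚ_p` under OUR kernel check; semi-synthetic models = consistency bookkeeping; nothing of [EtTh] asserted; no side taken on [IUTchIII]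
Cor. 3.12; typed ≠ proved.
-/

noncomputable section

namespace Literature.AnabelianGeometry.EtaleTheta

open Literature.AnabelianGeometry.SemiGraphs

variable (p : ℕ) [Fact p.Prime]

/-! ### `μ_N ⊆ K` for `N ∣ p − 1`, every `K / ℚ_p` -/

/-- **For `N ∣ p − 1` (or `p = N = 2`), every `N`-th root of unity of `ℚ̄_p` lies in EVERY intermediate field `K / ℚ_p`** — it is a
power of a primitive `N`-th root of unity of `ℚ_p` (Hensel). [cite: Serre1973, Ch. II §3.1 Prop. 7] -/
theorem coe_muN_mem_intermediateField_of_dvd_pred_or (K : IntermediateField ℚ_[p] (PadicAlgCl p)) (N : ℕ+)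
    (hN : (N : ℕ) ∣ p - 1 ∨ (p = 2 ∧ (N : ℕ) = 2)) (ζ : MuN p N) :
    (((ζ : (PadicAlgCl p)ˣ)) : PadicAlgCl p) ∈ K := by
  obtain ⟨z, hz⟩ := exists_isPrimitiveRoot_padic_of_dvd_pred_or p hN
  have hz' : IsPrimitiveRoot (algebraMap ℚ_[p] (PadicAlgCl p) z) N :=
    hz.map_of_injective (f := algebraMap ℚ_[p] (PadicAlgCl p)) (algebraMap ℚ_[p] (PadicAlgCl p)).injective
  have hζN : (((ζ : (PadicAlgCl p)ˣ)) : PadicAlgCl p) ^ (N : ℕ) = 1 := by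
    have h := (mem_rootsOfUnity _ _).mp ζ.2
    rw [← Units.val_pow_eq_pow_val, h, Units.val_one]
  haveI : NeZero (N : ℕ) := ⟨N.ne_zero⟩
  obtain ⟨i, -, hi⟩ := hz'.eq_pow_of_pow_eq_one hζN
  rw [← hi, ← map_pow]
  exact IntermediateField.algebraMap_mem K _

/-- **The binder `hμK` of the Cor. 2.9 count DISCHARGED at EVERY `ThetaSetting` for `N ∣ p − 1`** (or `p = N = 2`): `μ_N(ℚ̄_p) ⊆ K`.
[cite: MochizukiEtTh2009, Rmk 2.6.1 p.40] -/
theorem ThetaSetting.coe_muN_mem_K_of_dvd_pred_or (D : ThetaSetting p) (N : ℕ+)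
    (hN : (N : ℕ) ∣ p - 1 ∨ (p = 2 ∧ (N : ℕ) = 2)) :
    ∀ ζ : MuN p N, (((ζ : (PadicAlgCl p)ˣ)) : PadicAlgCl p) ∈ D.K :=
  coe_muN_mem_intermediateField_of_dvd_pred_or p D.K N hN

/-! ### The exact census at base field `K = ℚ_p` -/

/-- **Converse at `K = ℚ_p`**: if `μ_N(ℚ̄_p) ⊆ ℚ_p` then `N ∣ p − 1 ∨ (p = 2 ∧ N = 2)` — a Galois-fixed primitive root kills the mod-`N`
cyclotomic character (abc-iut-w5-d125's `galMuN_eq_one_iff`). [cite: Serre1973, Ch. II §3.1 Prop. 7] -/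
theorem dvd_pred_or_of_coe_muN_mem_bot (N : ℕ+)
    (h : ∀ ζ : MuN p N, (((ζ : (PadicAlgCl p)ˣ)) : PadicAlgCl p) ∈ (⊥ : IntermediateField ℚ_[p] (PadicAlgCl p))) :
    (N : ℕ) ∣ p - 1 ∨ (p = 2 ∧ (N : ℕ) = 2) := by
  rw [← galMuN_eq_one_iff]
  ext σ ζ
  have hfix : galMuN p N σ ζ = ζ := by
    apply Subtype.ext
    apply Units.ext
    obtain ⟨z, hz⟩ := IntermediateField.mem_bot.mp (h ζ)
    rw [galMuN_apply_coe, ← hz, AlgEquiv.commutes]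
  rw [hfix]
  rfl

/-- **`μ_N(ℚ̄_p) ⊆ ℚ_p ⇔ N ∣ p − 1 ∨ (p = 2 ∧ N = 2)`.** [cite: Serre1973, Ch. II §3.1 Prop. 7] -/
theorem coe_muN_mem_bot_iff (N : ℕ+) :
    (∀ ζ : MuN p N, (((ζ : (PadicAlgCl p)ˣ)) : PadicAlgCl p) ∈ (⊥ : IntermediateField ℚ_[p] (PadicAlgCl p))) ↔
      (N : ℕ) ∣ p - 1 ∨ (p = 2 ∧ (N : ℕ) = 2) :=
  ⟨dvd_pred_or_of_coe_muN_mem_bot p N, coe_muN_mem_intermediateField_of_dvd_pred_or p ⊥ N⟩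

/-- For ODD `N` the exceptional case is absent: `μ_N ⊆ ℚ_p ⇔ N ∣ p − 1`. [cite: Serre1973, Ch. II §3.1 Prop. 7] -/
theorem coe_muN_mem_bot_iff_of_odd (N : ℕ+) (hodd : Odd (N : ℕ)) :
    (∀ ζ : MuN p N, (((ζ : (PadicAlgCl p)ˣ)) : PadicAlgCl p) ∈ (⊥ : IntermediateField ℚ_[p] (PadicAlgCl p))) ↔
      (N : ℕ) ∣ p - 1 := by
  rw [coe_muN_mem_bot_iff]
  constructor
  · rintro (h | ⟨-, h2⟩)
    · exact h
    · rw [h2] at hodd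
      exact absurd even_two (Nat.not_even_iff_odd.mpr hodd)
  · exact Or.inl

namespace SettingModel

/-! ### At the models with `K = ℚ_p`: the cusped Krull model `κ′` and the cusped χ-model `χ′` -/

/-- The base field of `modelκ′` is `ℚ_p`. [cite: MochizukiEtTh2009, §1 p.11] -/
theorem modelκ'_K : (ThetaSetting.modelκ' p).K = ⊥ := rfl

/-- The base field of `modelχ′` is `ℚ_p`. [cite: MochizukiEtTh2009, §1 p.11] -/
theorem modelχ'_K : (ThetaSetting.modelχ' p).K = ⊥ := rfl

/-- **EXACT CENSUS of the binder `hμK` at `κ′`**: `μ_N ⊆ K(modelκ′) ⇔ N ∣ p − 1 ∨ (p = 2 ∧ N = 2)`. [cite: MochizukiEtTh2009, Rmk 2.6.1 p.40] -/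
theorem hμK_modelκ'_iff (N : ℕ+) :
    (∀ ζ : MuN p N, (((ζ : (PadicAlgCl p)ˣ)) : PadicAlgCl p) ∈ (ThetaSetting.modelκ' p).K) ↔
      (N : ℕ) ∣ p - 1 ∨ (p = 2 ∧ (N : ℕ) = 2) :=
  coe_muN_mem_bot_iff p N

/-- … for odd `l`: `⇔ l ∣ p − 1` — next to K11 (`CyclotomeMod 1 l = ∅` off `l ∣ p − 1`) and K10 (Prop. 2.6 the remaining binder), the
six-member count at `κ′` has ALL its arithmetic binders decided off the open positive cyclotome half. [cite: MochizukiEtTh2009, Cor 2.9 p.43] -/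
theorem hμK_modelκ'_iff_of_odd (l : ℕ+) (hodd : Odd (l : ℕ)) :
    (∀ ζ : MuN p l, (((ζ : (PadicAlgCl p)ˣ)) : PadicAlgCl p) ∈ (ThetaSetting.modelκ' p).K) ↔ (l : ℕ) ∣ p - 1 :=
  coe_muN_mem_bot_iff_of_odd p l hodd

/-- **EXACT CENSUS of the binder `hμK` at `χ′`** (the Kummer-carrying cusped model has `K = ℚ_p` too). [cite: MochizukiEtTh2009, Rmk 2.6.1 p.40] -/
theorem hμK_modelχ'_iff (N : ℕ+) :
    (∀ ζ : MuN p N, (((ζ : (PadicAlgCl p)ˣ)) : PadicAlgCl p) ∈ (ThetaSetting.modelχ' p).K) ↔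
      (N : ℕ) ∣ p - 1 ∨ (p = 2 ∧ (N : ℕ) = 2) :=
  coe_muN_mem_bot_iff p N

/-- … for odd `l` at `χ′`: `⇔ l ∣ p − 1`. [cite: MochizukiEtTh2009, Rmk 2.6.1 p.40] -/
theorem hμK_modelχ'_iff_of_odd (l : ℕ+) (hodd : Odd (l : ℕ)) :
    (∀ ζ : MuN p l, (((ζ : (PadicAlgCl p)ˣ)) : PadicAlgCl p) ∈ (ThetaSetting.modelχ' p).K) ↔ (l : ℕ) ∣ p - 1 :=
  coe_muN_mem_bot_iff_of_odd p l hodd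

end SettingModel

end Literature.AnabelianGeometry.EtaleTheta

end
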